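import Summits.HodgeConjecture.HodgeConjecture.Theorems.F0P3InnerFormClassificationV6    -- ★ V6 head module: kit, laws, `abs_expansion_le`, `coefficientFormula_of_laws`
import HarnessLib

/-!
# Crux `H413` — T5 v6 books pass, observation (D) of B-p08's consumption census: the COEFFICIENT FORMULA WITHOUT (L7′)∕(L7-det) —
# grouping the class sum by coordinates instead of assuming `c ↦ coordS S c` injective (Rogawski 1990 §14.6 pp. 238–239; Prop. 13.8.1)

Floor-0 programme P3 «U3-mult», seat B-p08 (g20); crux item stmt-HodgeConjecture-24833 (`HCCMUnconditional.H413`); RULING (V41) books pass, census memo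
`F0/P3/B-p08/g20/CENSUS-T5v6-law-consumption.B-p08g20.md` §D.  PROOF lane (`--supports stmt-HodgeConjecture-24833 --as helper`): theorems only — no `def`, no named
fact, no instance, no notation, no `sorry`; kit-parametric (any `𝔠 : ClassificationKit`).  HONEST LABEL: HC_CM is proved only modulo the printed citations until rung 0
closes; this file discharges none of them — it shows that the law (L7-det) `FlathDet` (via (L7′) `ClassDet`) is NOT NEEDED by the T5 engine.

WHY.  ★ `coefficientFormula_of_laws` (V6 engine, F:894 of the Lines dossier) uses `ClassDet` ONLY to make `κ : c ↦ coordS S c` injective on the fibre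
`{c ∣ germ (evp c) = germ (t(Π(ξ))) ∧ Adm S c}`, so as to re-index the class side of (14.6.2) by coordinates.  Injectivity is unnecessary: every fibre `κ⁻¹(x)` is FINITE
(a point `x = κ c` is unitary by `UnitaryCoord`, hence SEEN by some test function — `LinIndepS` applied to the indicator of `x` —, and the class sum tested against that
function is summable with terms `mult c · ch_S(x) ≠ 0` bounded away from `0`), so `m(x) := Σ_{κ c = x} mult c` regroups the summable class sum (`HasSum.sigma`), linear
independence gives `m(x) = E_ξ(x)` for every `x`, and `|E_ξ| ≤ 1` (★ `abs_expansion_le`) with `mult ≥ 1` forces each fibre to be a singleton with `mult c = E_ξ(coordS c)`.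

* `exists_chS_ne_zero_of_unitaryLoc` — a unitary coordinate is seen by some test function (from `LinIndepS`);
* **`coefficientFormula_of_laws_grouped`** — `CoefficientFormula` from `PerClassIdentity`, `TransferS`, `LinIndepS`, `UnitaryCoord`, `UnitaryPacket`, `APacketSpectral`,
  `LocalExpansion` and the trivial pin «`1 ≤ mult c`» — NO `ClassDet`, NO `FlathDet`;
* `eq_of_coordS_eq_of_laws` — (L7′) on every `ξ`-fibre as a COROLLARY (two Adm classes in the germ of `t(Π(ξ))` with the same coordinates coincide).

References: [Rogawski1990] §14.6 pp. 236–239 (proof of Thm. 14.6.4), Prop. 13.8.1 p. 206 (linear independence of characters); [FlathCorvallis1979] Thm. 3 (the statement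
made unnecessary here); [Langlands1980] pp. 208–211.
-/

set_option autoImplicit false
set_option linter.dupNamespace false

noncomputable section

open NumberField IsDedekindDomain MeasureTheory Filter
open scoped Matrix ComplexOrder BigOperators Classical Topology

namespace Summit.HodgeConjecture.HodgeConjecture.Cruxes.H413.F0P3InnerFormClassificationV6

open Literature.NumberTheory.Rogawski1990 Literature.NumberTheory.GaloisRepresentations
open Literature.NumberTheory.Automorphic Literature.NumberTheory.Automorphic.UnitaryGroup

namespace ClassificationKit

variable {L : Type} [Field L] [NumberField L] [IsCMField L] {H : Matrix (Fin 3) (Fin 3) L} {ι : L →+* ℂ} {T : GL (Fin 3) ℂ}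
  {hT : (T : Matrix (Fin 3) (Fin 3) ℂ)ᴴ * H.map ι * (T : Matrix (Fin 3) (Fin 3) ℂ) = Literature.Geometry.ComplexHyperbolic.BallModel.J}
  {μ : Measure (Gp L H).automorphicQuotient} [(Gp L H).IsAutomorphicMeasure μ] (𝔠 : ClassificationKit L H ι T hT μ)

/-- **A unitary coordinate is SEEN by some test function**: `LinIndepS` applied to the indicator of `x`. [cite: Rogawski1990, Prop. 13.8.1 p. 206] -/
theorem exists_chS_ne_zero_of_unitaryLoc (h6 : 𝔠.LinIndepS) (S : Finset (Places L)) (x : LocS L H S) (hx : 𝔠.UnitaryLoc S x) :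
    ∃ fS : 𝔠.TestS S, 𝔠.chS S x fS ≠ 0 := by
  by_contra hno
  push Not at hno
  have hsupp : ∀ (fS : 𝔠.TestS S) (y : LocS L H S), y ≠ x → (if y = x then (1 : ℂ) else 0) * 𝔠.chS S y fS = 0 := fun fS y hy => by
    rw [if_neg hy, zero_mul]
  have h := h6 S (fun y => if y = x then (1 : ℂ) else 0)
    (fun y hy => by
      by_cases hyx : y = x
      · rw [hyx]; exact hx
      · exact absurd (if_neg hyx) hy)
    (fun fS => summable_of_ne_finset_zero (s := {x}) fun y hy => hsupp fS y (by simpa only [Finset.mem_singleton] using hy))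
    (fun fS => by rw [tsum_eq_single x (hsupp fS), if_pos rfl, one_mul, hno fS]) x
  rw [if_pos rfl] at h
  exact one_ne_zero h

/-- **CORE: in the germ of `t(Π(ξ))` off `S ⊇ ram ξ`, an Adm class `c₀` has `mult c₀ = 1 = E_ξ(coordS S c₀)` and is the ONLY Adm class of the germ with its coordinates**
— from (14.6.2) per germ (`PerClassIdentity`), the transfer of test functions, linear independence of characters on unitary coordinates (`LinIndepS`, `UnitaryCoord`,
`UnitaryPacket`), the A-class spectral data and the local expansion at `ξ`, and «`1 ≤ mult c`»; NO `ClassDet`, NO `FlathDet`.  The fibres of `κ : c ↦ coordS S c` are finite (a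
unitary point is seen by a test function; summability with terms bounded away from `0`), `m(x) := Σ_{κ c = x} mult c` regroups the class sum (`HasSum.sigma`), `LinIndepS` gives
`m = E_ξ` pointwise, and `|E_ξ| ≤ 1 ≤ mult` (★ `abs_expansion_le`) makes every non-empty fibre a singleton of multiplicity one. [cite: Rogawski1990, §14.6 pp. 238–239 and Prop. 13.8.1] -/
theorem mult_eq_one_and_unique_of_laws_grouped
    (h0 : ClassificationKit.PerClassIdentity 𝔠) (hT : 𝔠.TransferS) (h6 : 𝔠.LinIndepS) (h6a : 𝔠.UnitaryCoord) (h6b : 𝔠.UnitaryPacket)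
    (hm1 : ∀ c : 𝔠.Cls, 1 ≤ 𝔠.mult c) (h8 : 𝔠.APacketSpectral) (h9 : 𝔠.LocalExpansion)
    (ξ : OneDimAutRepH L) (S : Finset (Places L)) (hS : 𝔠.ram ξ ⊆ S) (c₀ : 𝔠.Cls) (hc₀ : EqOff L H S (𝔠.evp c₀) (𝔠.tXi ξ)) (hr₀ : 𝔠.Adm S c₀) :
    𝔠.mult c₀ = 1 ∧ 𝔠.expansion ξ S (𝔠.coordS S c₀) = 1 ∧
      ∀ c' : 𝔠.Cls, EqOff L H S (𝔠.evp c') (𝔠.tXi ξ) → 𝔠.Adm S c' → 𝔠.coordS S c' = 𝔠.coordS S c₀ → c' = c₀ := by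
  classical
  -- the fibre of the germ of `t(Π(ξ))` among Adm classes, and its coordinate map `κ`
  let Fp : 𝔠.Cls → Prop := fun c => germ L H S (𝔠.evp c) = germ L H S (𝔠.tXi ξ) ∧ 𝔠.Adm S c
  let κ : {c : 𝔠.Cls // Fp c} → LocS L H S := fun c => 𝔠.coordS S c.1
  have hκ : ∀ c : {c : 𝔠.Cls // Fp c}, κ c = 𝔠.coordS S c.1 := fun _ => rfl
  -- the tested identity over the fibre, for every `fS` (as in ★ `coefficientFormula_of_laws`)
  have key : ∀ fS : 𝔠.TestS S,
      Summable (fun c : {c : 𝔠.Cls // Fp c} => (𝔠.mult c.1 : ℂ) * 𝔠.chS S (κ c) fS) ∧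
      (Function.support fun x : LocS L H S => (𝔠.expansion ξ S x : ℂ) * 𝔠.chS S x fS).Finite ∧
      ∑' c : {c : 𝔠.Cls // Fp c}, (𝔠.mult c.1 : ℂ) * 𝔠.chS S (κ c) fS = ∑ᶠ x, (𝔠.expansion ξ S x : ℂ) * 𝔠.chS S x fS := by
    intro fS
    obtain ⟨fSG, fSH, hM⟩ := hT S fS
    obtain ⟨hsc, -, -, hid⟩ := h0 S (germ L H S (𝔠.tXi ξ)) fS fSG fSH hM
    obtain ⟨-, -, -, -, hAP⟩ := h8 ξ S hS
    obtain ⟨hQ, hρ⟩ := hAP fSG fSH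
    obtain ⟨hfin, hloc⟩ := (h9 ξ S hS).2 fS fSG fSH hM
    exact ⟨hsc, hfin, by rw [hid, hQ, hρ, hloc]⟩
  -- every fibre of `κ` is FINITE
  have hfinite : ∀ x : LocS L H S, Finite {c : {c : 𝔠.Cls // Fp c} // κ c = x} := by
    intro x
    by_cases hne : Nonempty {c : {c : 𝔠.Cls // Fp c} // κ c = x}
    · obtain ⟨⟨c₁, hc₁⟩⟩ := hne
      have hxu : 𝔠.UnitaryLoc S x := by rw [← hc₁, hκ]; exact h6a S c₁.1
      obtain ⟨fS, hfS⟩ := 𝔠.exists_chS_ne_zero_of_unitaryLoc h6 S x hxu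
      obtain ⟨hsc, -, -⟩ := key fS
      -- the restriction of the summable class family to the fibre has terms of norm `≥ ‖ch_S(x)(fS)‖ > 0`
      have hsub : Summable (fun c : {c : {c : 𝔠.Cls // Fp c} // κ c = x} => (𝔠.mult c.1.1 : ℂ) * 𝔠.chS S (κ c.1) fS) :=
        hsc.comp_injective Subtype.val_injective
      have hlim := hsub.tendsto_cofinite_zero
      rw [NormedAddGroup.tendsto_nhds_zero] at hlim
      have hev := hlim ‖𝔠.chS S x fS‖ (norm_pos_iff.2 hfS)
      rw [Filter.eventually_cofinite] at hev
      have huniv : {c : {c : {c : 𝔠.Cls // Fp c} // κ c = x} | ¬ ‖(𝔠.mult c.1.1 : ℂ) * 𝔠.chS S (κ c.1) fS‖ < ‖𝔠.chS S x fS‖} = Set.univ := by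
        refine Set.eq_univ_of_forall fun c => ?_
        simp only [Set.mem_setOf_eq, not_lt, c.2, norm_mul, Complex.norm_natCast]
        have h1 : (1 : ℝ) ≤ (𝔠.mult c.1.1 : ℝ) := by exact_mod_cast hm1 c.1.1
        nlinarith [norm_nonneg (𝔠.chS S x fS)]
      rw [huniv] at hev
      exact Set.finite_univ_iff.1 hev
    · exact ⟨fun c => (hne ⟨c⟩).elim, fun i => i.elim0, fun c => (hne ⟨c⟩).elim, fun i => i.elim0⟩
  haveI : ∀ x : LocS L H S, Fintype {c : {c : 𝔠.Cls // Fp c} // κ c = x} := fun x => Fintype.ofFinite _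
  -- the grouped multiplicity function `m x := Σ_{κ c = x} mult c`
  let m : LocS L H S → ℂ := fun x => ∑ c : {c : {c : 𝔠.Cls // Fp c} // κ c = x}, (𝔠.mult c.1.1 : ℂ)
  -- regrouping the class sum by the fibres of `κ`
  have grouped : ∀ fS : 𝔠.TestS S, HasSum (fun x => m x * 𝔠.chS S x fS)
      (∑' c : {c : 𝔠.Cls // Fp c}, (𝔠.mult c.1 : ℂ) * 𝔠.chS S (κ c) fS) := by
    intro fS
    obtain ⟨hsc, -, -⟩ := key fS
    have ha : HasSum ((fun c : {c : 𝔠.Cls // Fp c} => (𝔠.mult c.1 : ℂ) * 𝔠.chS S (κ c) fS) ∘ Equiv.sigmaFiberEquiv κ)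
        (∑' c : {c : 𝔠.Cls // Fp c}, (𝔠.mult c.1 : ℂ) * 𝔠.chS S (κ c) fS) :=
      (Equiv.hasSum_iff (Equiv.sigmaFiberEquiv κ)).2 hsc.hasSum
    refine ha.sigma fun x => ?_
    have heq : (fun c : {c : {c : 𝔠.Cls // Fp c} // κ c = x} =>
        ((fun c : {c : 𝔠.Cls // Fp c} => (𝔠.mult c.1 : ℂ) * 𝔠.chS S (κ c) fS) ∘ Equiv.sigmaFiberEquiv κ) ⟨x, c⟩) =
        fun c => (𝔠.mult c.1.1 : ℂ) * 𝔠.chS S x fS := by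
      funext c
      simp only [Function.comp_apply, Equiv.sigmaFiberEquiv_apply, c.2]
    rw [heq, show m x * 𝔠.chS S x fS = ∑ c : {c : {c : 𝔠.Cls // Fp c} // κ c = x}, (𝔠.mult c.1.1 : ℂ) * 𝔠.chS S x fS by
      rw [Finset.sum_mul]]
    exact hasSum_fintype _
  -- linear independence (L2) applied to `m − E_ξ`, supported on unitary coordinates
  have hb : ∀ x : LocS L H S, m x - (𝔠.expansion ξ S x : ℂ) = 0 := by
    refine h6 S (fun x => m x - (𝔠.expansion ξ S x : ℂ)) ?_ ?_ ?_
    · intro x hx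
      by_cases hEx : 𝔠.expansion ξ S x = 0
      · have hmx : m x ≠ 0 := by
          intro h; apply hx; rw [h, hEx, Rat.cast_zero, sub_zero]
        have hne : Nonempty {c : {c : 𝔠.Cls // Fp c} // κ c = x} := by
          by_contra h
          apply hmx
          haveI : IsEmpty {c : {c : 𝔠.Cls // Fp c} // κ c = x} := not_nonempty_iff.1 h
          exact Finset.sum_of_isEmpty _
        obtain ⟨⟨c₁, hc₁⟩⟩ := hne
        rw [← hc₁, hκ]
        exact h6a S c₁.1
      · exact h6b ξ S x hS hEx
    · intro fS
      obtain ⟨-, hfin, -⟩ := key fS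
      simpa only [sub_mul] using (grouped fS).summable.sub (summable_of_hasFiniteSupport hfin)
    · intro fS
      obtain ⟨-, hfin, hid⟩ := key fS
      simp only [sub_mul]
      rw [(grouped fS).summable.tsum_sub (summable_of_hasFiniteSupport hfin), (grouped fS).tsum_eq, hid, tsum_eq_finsum hfin, sub_self]
  -- read the coefficient at `c₀`: the fibre sum `s = Σ_{κ c = κ c₀} mult c` satisfies `mult c₀ ≤ s = E_ξ ≤ 1 ≤ mult c₀`
  have hc₀F : Fp c₀ := ⟨(germ_eq_germ_iff L H S _ _).2 hc₀, hr₀⟩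
  have hmE : m (𝔠.coordS S c₀) = (𝔠.expansion ξ S (𝔠.coordS S c₀) : ℂ) := sub_eq_zero.1 (hb _)
  set s : ℕ := ∑ c : {c : {c : 𝔠.Cls // Fp c} // κ c = 𝔠.coordS S c₀}, 𝔠.mult c.1.1 with hsdef
  have hms : m (𝔠.coordS S c₀) = (s : ℂ) := by rw [hsdef, Nat.cast_sum]
  have hsE : (s : ℚ) = 𝔠.expansion ξ S (𝔠.coordS S c₀) := by
    have h : ((s : ℚ) : ℂ) = ((𝔠.expansion ξ S (𝔠.coordS S c₀) : ℚ) : ℂ) := by rw [Rat.cast_natCast, ← hms, hmE]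
    exact_mod_cast h
  have hs1 : s ≤ 1 := by
    have h : (s : ℚ) ≤ 1 := hsE ▸ (le_abs_self _).trans (𝔠.abs_expansion_le ξ S (h9 ξ S hS).1 _)
    exact_mod_cast h
  let e₀ : {c : {c : 𝔠.Cls // Fp c} // κ c = 𝔠.coordS S c₀} := ⟨⟨c₀, hc₀F⟩, rfl⟩
  have hc₀s : 𝔠.mult c₀ ≤ s :=
    Finset.single_le_sum (f := fun c : {c : {c : 𝔠.Cls // Fp c} // κ c = 𝔠.coordS S c₀} => 𝔠.mult c.1.1) (fun _ _ => Nat.zero_le _)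
      (Finset.mem_univ e₀)
  have hm₀ : 𝔠.mult c₀ = 1 := le_antisymm (hc₀s.trans hs1) (hm1 c₀)
  have hs : s = 1 := le_antisymm hs1 ((hm1 c₀).trans hc₀s)
  refine ⟨hm₀, by exact_mod_cast (hs ▸ hsE).symm, fun c' hc' hr' hco => ?_⟩
  -- uniqueness in the fibre: a second class would push the fibre sum to `≥ 2`
  by_contra hne
  let e₁ : {c : {c : 𝔠.Cls // Fp c} // κ c = 𝔠.coordS S c₀} := ⟨⟨c', (germ_eq_germ_iff L H S _ _).2 hc', hr'⟩, hco⟩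
  have hne01 : e₀ ≠ e₁ := fun h => hne (congrArg (fun e : {c : {c : 𝔠.Cls // Fp c} // κ c = 𝔠.coordS S c₀} => e.1.1) h).symm
  have two_le : 2 ≤ s :=
    calc (2 : ℕ) ≤ 𝔠.mult c₀ + 𝔠.mult c' := Nat.add_le_add (hm1 c₀) (hm1 c')
      _ = ∑ c ∈ ({e₀, e₁} : Finset _), 𝔠.mult c.1.1 := by rw [Finset.sum_pair hne01]
      _ ≤ s := Finset.sum_le_sum_of_subset_of_nonneg (Finset.subset_univ _) fun _ _ _ => Nat.zero_le _
  omega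

/-- **THE COEFFICIENT FORMULA WITHOUT (L7′)∕(L7-det)** — ★ `CoefficientFormula` AS STATED, from the laws of ★ `coefficientFormula_of_laws` with `ClassDet` REPLACED by the trivial
pin «`1 ≤ mult c`». [cite: Rogawski1990, §14.6 pp. 238–239 and Prop. 13.8.1] -/
theorem coefficientFormula_of_laws_grouped
    (h0 : ClassificationKit.PerClassIdentity 𝔠) (hT : 𝔠.TransferS) (h6 : 𝔠.LinIndepS) (h6a : 𝔠.UnitaryCoord) (h6b : 𝔠.UnitaryPacket)
    (hm1 : ∀ c : 𝔠.Cls, 1 ≤ 𝔠.mult c) (h8 : 𝔠.APacketSpectral) (h9 : 𝔠.LocalExpansion) :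
    𝔠.CoefficientFormula := by
  intro ξ S hS c₀ hc₀ hr₀
  obtain ⟨hm, hE, -⟩ := 𝔠.mult_eq_one_and_unique_of_laws_grouped h0 hT h6 h6a h6b hm1 h8 h9 ξ S hS c₀ hc₀ hr₀
  rw [hm, hE, Nat.cast_one]

/-- **(L7′) ON EVERY `ξ`-FIBRE, AS A COROLLARY (no `FlathDet`)**: two Adm classes in the germ of `t(Π(ξ))` off `S ⊇ ram ξ` with the same `S ∪ ∞`-coordinates COINCIDE.
[cite: Rogawski1990, §14.6 pp. 238–239] [cite: FlathCorvallis1979, Thm. 3] -/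
theorem eq_of_coordS_eq_of_laws
    (h0 : ClassificationKit.PerClassIdentity 𝔠) (hT : 𝔠.TransferS) (h6 : 𝔠.LinIndepS) (h6a : 𝔠.UnitaryCoord) (h6b : 𝔠.UnitaryPacket)
    (hm1 : ∀ c : 𝔠.Cls, 1 ≤ 𝔠.mult c) (h8 : 𝔠.APacketSpectral) (h9 : 𝔠.LocalExpansion)
    (ξ : OneDimAutRepH L) (S : Finset (Places L)) (hS : 𝔠.ram ξ ⊆ S) (c c' : 𝔠.Cls)
    (hc : EqOff L H S (𝔠.evp c) (𝔠.tXi ξ)) (hc' : EqOff L H S (𝔠.evp c') (𝔠.tXi ξ)) (hr : 𝔠.Adm S c) (hr' : 𝔠.Adm S c')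
    (hco : 𝔠.coordS S c = 𝔠.coordS S c') : c = c' :=
  ((𝔠.mult_eq_one_and_unique_of_laws_grouped h0 hT h6 h6a h6b hm1 h8 h9 ξ S hS c hc hr).2.2 c' hc' hr' hco.symm).symm

end ClassificationKit

end Summit.HodgeConjecture.HodgeConjecture.Cruxes.H413.F0P3InnerFormClassificationV6

end
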